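import Summits.HodgeConjecture.HodgeConjecture.Theorems.VHCAbelianSchemesRoadSecantAnchorDefs
import Summits.HodgeConjecture.HodgeConjecture.Theorems.VHCAbelianSchemesRoadServedFibreItems
import Summits.HodgeConjecture.HodgeConjecture.Theorems.VHCAbelianSchemesRoadDesignSufficient
import Summits.HodgeConjecture.HodgeConjecture.Theorems.VHCAbelianSchemesRoadSemiregularSheafRepresentativesTwAtStubLefschetzRegimeTw
import HarnessLib

/-!
# Road b02 (`VHCAbelianSchemesRoad`, D-0059) — THE SECANT-ANCHOR INSTANCE at `(6, 3)`: the anchored carrier statement is a THEOREM,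
# the through-anchor piece is PROVED, the residual is EQUIVALENT to the rung (all fact-free)

research route conditional on HC_CM; not a corollary; Q11.4-sentence-2 already refuted in dim ≥ 3.

FACT-FREE companion of `…SecantAnchorDefs` (seat b02 gen 86; ring2 LEAD gen 151 ruling L151.4: helpers `--supports` stmt-HodgeConjecture-19787,
skeleton v2 of record). For an object class `𝒪` with NULL DATA and any cell `(n, p)`, the OUTPUT-level anchor data
(`carrierAnchorClassesAt 𝒪 n p`, `carrierServedClassesAt 𝒪 n p`) satisfy PART AA's anchored carrier statement BY CONSTRUCTION:

* §1 `anchoredCarrierAt_carrierAnchors_of_hasNullDatum` — a served class `w ∈ ℂ·θᵖ + ℂ·v` (`v` the `p`-th class of a pinned datum, off the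
  ray) is served by THAT datum rescaled (`w = α·θᵖ + β·v`, `β ≠ 0`: `κ_p = v = β⁻¹·w − αβ⁻¹·θᵖ`) or, on the ray (`β = 0`), by the null datum
  (PART Z-b §4 `pinnedDesign_of_mem_span_cupPowTwo_of_hasNullDatum`). Elementary membership lemmas. Transport of the anchor data along
  isomorphisms GIVEN that `𝒪` respects isomorphisms (hypothesis inline, as in `…DesignNecessary` §3; not assumed of a general door) — the
  `htr` input of PART AA-c.
* §2 the `(6, 3)` twisted instance (names fixed by the cell's bus): `anchorCarrier63 : ∀ C, AnchorCarrier63 C` (the twisted door has null data,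
  PART V `hasNullDatum_twistedReflexiveClass`); `throughSecantAnchor63 : ∀ C, ThroughSecantAnchor63 C` (PART AA transport = PART Z-b §5);
  `rung_sixfoldMiddleTw_of_residual63` / `residual63_of_rung_sixfoldMiddleTw` / **`residual63_iff_rung_sixfoldMiddleTw`** (finding F4 (iii):
  with output-level anchors the residual IS the rung — LEAD's C2 pre-read «cut by the outcome», whence no v3 registration); the registered
  statement shape `forall_residual63_iff_forall_rung`; and the crux BY NAME from the `(4,2)` cell, the `(6,3)` residual and the tail
  (`twAtDiag_of_firstCell_of_residual63_of_tail`, PART AA-d with the anchored carrier discharged).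

What the PREPRINT adds is NOT here: that `secantAnchorSixfold C Y` is INHABITED at Markman's quotient sixfolds `(Y_d, h)`, `d` even `≥ 4`
(`Literature.AlgebraicGeometry.HodgeTheory.Markman2025_secantQuotientAnchor_twistedCarrier_sixfold`, statement lane) — companion
`…SecantAnchorMarkman` (variety level, this seat) and `…SecantAnchorInhabited` (pencil level, ring2-b03). Nothing here says any cell, the
residual, K-SR♭∃, VHC, `HC_AV` or HC holds; `HC_CM` occurs nowhere. References: [cite: Bloch1972Semiregularity, Remark (7.5)]
[cite: BuchweitzFlenner2003, §5 Thm. 5.1] [cite: vanGeemen1994HodgeAV, §2.4 and Thm. 4.11] [cite: Markman2025SecantWeil, Thm. 1.4.1, §1.5 and Thm. 1.5.1].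
-/

noncomputable section

open CategoryTheory CategoryTheory.Limits AlgebraicGeometry Topology

namespace Summit.HodgeConjecture.HodgeConjecture.Ring2.SemiregularRepresentatives

-- the cell's namespace repeats the summit name (`Summit.HodgeConjecture.HodgeConjecture…`), as in every `Ring2*` file
set_option linter.dupNamespace false

open Literature.AlgebraicGeometry Literature.AlgebraicGeometry.Motives
open Literature.AlgebraicGeometry.HodgeTheory
open Literature.AlgebraicTopology.SingularHomology
open Literature.Barriers.HodgeConjecture (divisorClassesSpan)
open Summit.Ventures.HSemireg (ObjClass)

/-! ## §1 Door-generic: the output-level anchor data satisfy the anchored carrier statement -/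

section Generic

variable {𝒪 : ObjClass} {n p : ℕ} {X : SchemeOver ℂ} {θ : complexBetti X 2}

/-- Membership in the off-ray pinned classes, unfolded (definitional). [cite: Bloch1972Semiregularity, Remark (7.5)] -/
theorem mem_pinnedOffRayClassesAt_iff {v : complexBetti X (2 * p)} :
    v ∈ pinnedOffRayClassesAt 𝒪 n p X θ ↔ v ∉ (ℂ ∙ cupPowTwo θ p) ∧
      ∃ (I : Finset ℕ) (κ : (q : ℕ) → complexBetti X (2 * q)) (c : ℕ → ℂ),
        p ∈ I ∧ 𝒪 n X I κ ∧ κ p = v ∧ ∀ q ∈ I, q ≠ p → κ q = c q • cupPowTwo θ q :=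
  Iff.rfl

/-- Membership in the carrier-anchor classes, unfolded (definitional). [cite: Bloch1972Semiregularity, Remark (7.5)] -/
theorem mem_carrierAnchorClassesAt_iff :
    θ ∈ carrierAnchorClassesAt 𝒪 n p X ↔ (pinnedOffRayClassesAt 𝒪 n p X θ).Nonempty :=
  Iff.rfl

/-- Membership in the served classes: `w` lies on the plane `ℂ·θᵖ + ℂ·v` of some off-ray pinned class `v`. [cite: Bloch1972Semiregularity, Remark (7.5)] -/
theorem mem_carrierServedClassesAt_iff {w : complexBetti X (2 * p)} :
    w ∈ carrierServedClassesAt 𝒪 n p X θ ↔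
      ∃ v ∈ pinnedOffRayClassesAt 𝒪 n p X θ, w ∈ Submodule.span ℂ {cupPowTwo θ p, v} := by
  simp only [carrierServedClassesAt, Set.mem_iUnion, SetLike.mem_coe, exists_prop]

/-- **A pinned datum with `p`-th class off the ray makes `θ` an anchor class** (the membership form used by the Markman instance).
[cite: Bloch1972Semiregularity, Remark (7.5)] [cite: Markman2025SecantWeil, §1.5 and Cor. 4.0.4] -/
theorem mem_carrierAnchorClassesAt_of_datum {I : Finset ℕ} {κ : (q : ℕ) → complexBetti X (2 * q)} {c : ℕ → ℂ}
    (hpI : p ∈ I) (h𝒪 : 𝒪 n X I κ) (hoff : κ p ∉ (ℂ ∙ cupPowTwo θ p))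
    (hκq : ∀ q ∈ I, q ≠ p → κ q = c q • cupPowTwo θ q) : θ ∈ carrierAnchorClassesAt 𝒪 n p X :=
  ⟨κ p, hoff, I, κ, c, hpI, h𝒪, rfl, hκq⟩

/-- **The plane `ℂ·θᵖ + ℂ·κ_p` of a pinned datum with `κ_p` off the ray is served.** [cite: Bloch1972Semiregularity, Remark (7.5)]
[cite: Markman2025SecantWeil, Thm. 1.4.1 (4th item)] -/
theorem span_le_carrierServedClassesAt_of_datum {I : Finset ℕ} {κ : (q : ℕ) → complexBetti X (2 * q)} {c : ℕ → ℂ}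
    (hpI : p ∈ I) (h𝒪 : 𝒪 n X I κ) (hoff : κ p ∉ (ℂ ∙ cupPowTwo θ p))
    (hκq : ∀ q ∈ I, q ≠ p → κ q = c q • cupPowTwo θ q) :
    (Submodule.span ℂ {cupPowTwo θ p, κ p} : Set (complexBetti X (2 * p))) ⊆ carrierServedClassesAt 𝒪 n p X θ := fun _ hw ↦
  mem_carrierServedClassesAt_iff.2 ⟨κ p, ⟨hoff, I, κ, c, hpI, h𝒪, rfl, hκq⟩, hw⟩

/-- The Lefschetz ray `ℂ·θᵖ` is served at every anchor class. [cite: vanGeemen1994HodgeAV, §2.4] -/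
theorem span_cupPowTwo_le_carrierServedClassesAt (hθ : θ ∈ carrierAnchorClassesAt 𝒪 n p X) :
    ((ℂ ∙ cupPowTwo θ p : Submodule ℂ (complexBetti X (2 * p))) : Set (complexBetti X (2 * p))) ⊆ carrierServedClassesAt 𝒪 n p X θ := by
  obtain ⟨v, hv⟩ := hθ
  intro w hw
  refine mem_carrierServedClassesAt_iff.2 ⟨v, hv, ?_⟩
  exact Submodule.span_mono (Set.singleton_subset_iff.2 (Set.mem_insert _ _)) hw

/-- Every off-ray pinned class is itself served. [cite: Bloch1972Semiregularity, Remark (7.5)] -/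
theorem mem_carrierServedClassesAt_of_mem_pinnedOffRayClassesAt {v : complexBetti X (2 * p)} (hv : v ∈ pinnedOffRayClassesAt 𝒪 n p X θ) :
    v ∈ carrierServedClassesAt 𝒪 n p X θ :=
  mem_carrierServedClassesAt_iff.2 ⟨v, hv, Submodule.subset_span (Set.mem_insert_of_mem _ (Set.mem_singleton v))⟩

/-- An anchor class has a served class OFF the Lefschetz ray (the served set is not reduced to the ray). [cite: Markman2025SecantWeil, Thm. 1.4.1 (4th item)] -/
theorem exists_mem_carrierServedClassesAt_not_mem_span (hθ : θ ∈ carrierAnchorClassesAt 𝒪 n p X) :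
    ∃ w ∈ carrierServedClassesAt 𝒪 n p X θ, w ∉ (ℂ ∙ cupPowTwo θ p) := by
  obtain ⟨v, hv⟩ := hθ
  exact ⟨v, mem_carrierServedClassesAt_of_mem_pinnedOffRayClassesAt hv, hv.1⟩

/-- **THE OUTPUT-LEVEL ANCHOR DATA SATISFY THE ANCHORED CARRIER STATEMENT, for every door with null data and every cell** (finding F4 (iii)):
a served `w = α·θᵖ + β·v` is served by the datum of `v` rescaled when `β ≠ 0` (`κ_p = v = β⁻¹·w + (−β⁻¹α)·θᵖ`), and by the null datum when
`β = 0` (`w` on the ray). Fact-free. [cite: Bloch1972Semiregularity, Remark (7.5)] [cite: BuchweitzFlenner2003, §5 Thm. 5.1 (hypotheses)] -/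
theorem anchoredCarrierAt_carrierAnchors_of_hasNullDatum (h𝒪 : HasNullDatum 𝒪) :
    AnchoredCarrierAt 𝒪 n p (fun X θ => θ ∈ carrierAnchorClassesAt 𝒪 n p X) (carrierServedClassesAt 𝒪 n p) := by
  intro X θ _ w hw _
  obtain ⟨v, ⟨_, I, κ, c, hpI, h𝒪v, hκp, hκq⟩, hwspan⟩ := mem_carrierServedClassesAt_iff.1 hw
  obtain ⟨α, β, hαβ⟩ := Submodule.mem_span_pair.1 hwspan
  by_cases hβ : β = 0
  · -- `w = α·θᵖ` is on the ray: the null datum serves it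
    have hray : w ∈ ℂ ∙ cupPowTwo θ p := by
      rw [← hαβ, hβ, zero_smul, add_zero]
      exact Submodule.smul_mem _ α (Submodule.mem_span_singleton_self _)
    exact pinnedDesign_of_mem_span_cupPowTwo_of_hasNullDatum h𝒪 n X θ hray
  · -- rescale the datum of `v`
    refine ⟨I, κ, β⁻¹, Function.update c p (-(β⁻¹ * α)), hpI, h𝒪v, inv_ne_zero hβ, ?_, ?_⟩
    · rw [hκp, Function.update_self, ← hαβ, smul_add, smul_smul, smul_smul, inv_mul_cancel₀ hβ, one_smul, neg_smul]
      abel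
    · intro q hq hqp
      rw [Function.update_of_ne hqp]
      exact hκq q hq hqp

/-- **Transport of the anchor data along an isomorphism, for a door that RESPECTS ISOMORPHISMS** (hypothesis `hresp`, stated inline as in
`…DesignNecessary` §3 — not assumed of a general object class): `θ ∈` anchors of `X` and `w` served there give `e.inv^*θ ∈` anchors of `X'`
and `e.inv^*w` served there, for `e : X ≅ X'` — the `htr` input of PART AA-c's non-vacuity lemmas. [folklore] [cite: HatcherAT2002, Prop. 3.10] -/
theorem carrierAnchors_transport_of_respectsIso
    (hresp : ∀ (n : ℕ) ⦃Y Y' : SchemeOver ℂ⦄ (e : Y' ≅ Y) (I : Finset ℕ) (κ : (q : ℕ) → complexBetti Y (2 * q)),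
      𝒪 n Y I κ → 𝒪 n Y' I (fun q ↦ complexBetti.map e.hom (2 * q) (κ q)))
    ⦃X X' : SchemeOver ℂ⦄ (e : X ≅ X') (θ : complexBetti X 2) (w : complexBetti X (2 * p))
    (hθ : θ ∈ carrierAnchorClassesAt 𝒪 n p X) (hw : w ∈ carrierServedClassesAt 𝒪 n p X θ) :
    complexBetti.map e.inv 2 θ ∈ carrierAnchorClassesAt 𝒪 n p X' ∧
      complexBetti.map e.inv (2 * p) w ∈ carrierServedClassesAt 𝒪 n p X' (complexBetti.map e.inv 2 θ) := by
  -- transport of one pinned datum along `e.symm : X' ≅ X`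
  have hpow : ∀ q : ℕ, complexBetti.map e.inv (2 * q) (cupPowTwo θ q) = cupPowTwo (complexBetti.map e.inv 2 θ) q :=
    fun q ↦ map_cupPowTwo _ θ q
  have hinj : ∀ k : ℕ, Function.Injective (complexBetti.map e.inv k) := fun k x y hxy ↦ by
    have := congrArg (complexBetti.map e.hom k) hxy
    rwa [e.complexBetti_map_hom_map_inv, e.complexBetti_map_hom_map_inv] at this
  have transport : ∀ v ∈ pinnedOffRayClassesAt 𝒪 n p X θ,
      complexBetti.map e.inv (2 * p) v ∈ pinnedOffRayClassesAt 𝒪 n p X' (complexBetti.map e.inv 2 θ) := by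
    rintro v ⟨hvoff, I, κ, c, hpI, h𝒪v, hκp, hκq⟩
    refine ⟨fun hmem ↦ hvoff ?_, I, fun q ↦ complexBetti.map e.inv (2 * q) (κ q), c, hpI, hresp n e.symm I κ h𝒪v,
      by simp only [hκp], ?_⟩
    · obtain ⟨t, ht⟩ := Submodule.mem_span_singleton.1 hmem
      rw [← hpow p, ← map_smul] at ht
      exact Submodule.mem_span_singleton.2 ⟨t, hinj _ ht⟩
    · intro q hq hqp
      change complexBetti.map e.inv (2 * q) (κ q) = _
      rw [hκq q hq hqp, map_smul, hpow q]
  obtain ⟨v₀, hv₀⟩ := hθ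
  obtain ⟨v, hv, hwspan⟩ := mem_carrierServedClassesAt_iff.1 hw
  refine ⟨⟨_, transport v₀ hv₀⟩, mem_carrierServedClassesAt_iff.2 ⟨_, transport v hv, ?_⟩⟩
  obtain ⟨α, β, hαβ⟩ := Submodule.mem_span_pair.1 hwspan
  rw [← hαβ, map_add, map_smul, map_smul, hpow p]
  exact Submodule.mem_span_pair.2 ⟨α, β, rfl⟩

end Generic

/-! ## §2 The `(6, 3)` twisted instance -/

section Twisted

/-- **`AnchorCarrier63 C` HOLDS, fact-free** (finding F4 (iii); the twisted door has null data for every notion containing Buchweitz–Flenner's,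
PART V `hasNullDatum_twistedReflexiveClass`). [cite: Bloch1972Semiregularity, Remark (7.5)] [cite: BuchweitzFlenner2003, §5 Thm. 5.1 (hypotheses)] -/
theorem anchorCarrier63 : ∀ C : ChernCharacterBetti, AnchorCarrier63 C := fun C ↦
  anchoredCarrierAt_carrierAnchors_of_hasNullDatum
    (hasNullDatum_twistedReflexiveClass C _ fun _ _ _ _ h ↦ Or.inr h)

/-- **`ThroughSecantAnchor63 C` HOLDS, fact-free: the `(6, 3)` rung on every pencil through a served secant-anchor fibre** (PART AA transport =
PART Z-b §5, fed with `anchorCarrier63`). Its range is inhabited modulo the PREPRINT (companion files) — the rung's first proved sub-regime.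
[cite: Bloch1972Semiregularity, Remark (7.5)] [cite: Markman2025SecantWeil, Thm. 1.4.1 and Thm. 1.5.1] [cite: VoisinHodgeI2002, §7.1.2] -/
theorem throughSecantAnchor63 : ∀ C : ChernCharacterBetti, ThroughSecantAnchor63 C := fun C ↦
  under_hasServedFibre_of_anchoredCarrierAt (anchorCarrier63 C)

variable {C : ChernCharacterBetti}

/-- **The `(6, 3)` residual gives the `(6, 3)` rung** (anchored carrier discharged by `anchorCarrier63`; excluded middle on «has a served
fibre», PART AA). [cite: Bloch1972Semiregularity, Remark (7.5)] [cite: Markman2025SecantWeil, Thm. 1.4.1 and Thm. 1.5.1] [cite: vanGeemen1994HodgeAV, Thm. 4.11] -/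
theorem rung_sixfoldMiddleTw_of_residual63 (hR : Residual63 C) :
    LefAtExceptionalRegimeSixfoldMiddle (Literature.AlgebraicGeometry.HodgeTheory.twistedReflexiveClass C
      (fun n X₀ I E => Summit.Ventures.HSemireg.gluableSigmaAdmissible n X₀ I E ∨
        Literature.AlgebraicGeometry.HodgeTheory.bfSingleAdmissible n X₀ I E)) :=
  lefAtExceptionalRegimeSixfoldMiddle_of_anchoredCarrierAt_of_under_not (anchorCarrier63 C) hR

/-- **The `(6, 3)` rung gives the `(6, 3)` residual** (no slack: a conditional cell is weaker than the cell).
[cite: Bloch1972Semiregularity, Remark (7.5)] [cite: vanGeemen1994HodgeAV, §2.4] -/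
theorem residual63_of_rung_sixfoldMiddleTw
    (h : LefAtExceptionalRegimeSixfoldMiddle (Literature.AlgebraicGeometry.HodgeTheory.twistedReflexiveClass C
      (fun n X₀ I E => Summit.Ventures.HSemireg.gluableSigmaAdmissible n X₀ I E ∨
        Literature.AlgebraicGeometry.HodgeTheory.bfSingleAdmissible n X₀ I E))) :
    Residual63 C :=
  under_63_of_rung_sixfoldMiddleTw h _

/-- **`Residual63 C ↔` the `(6, 3)` rung** — with OUTPUT-level anchors the residual IS the rung (finding F4 (iii); LEAD gen 151's C2 pre-read:
«cut by the outcome», whence skeleton v2 stays of record and this instance lands as helpers). [cite: Bloch1972Semiregularity, Remark (7.5)]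
[cite: Markman2025SecantWeil, Thm. 1.5.1] [cite: vanGeemen1994HodgeAV, Thm. 4.11] -/
theorem residual63_iff_rung_sixfoldMiddleTw :
    Residual63 C ↔ LefAtExceptionalRegimeSixfoldMiddle (Literature.AlgebraicGeometry.HodgeTheory.twistedReflexiveClass C
      (fun n X₀ I E => Summit.Ventures.HSemireg.gluableSigmaAdmissible n X₀ I E ∨
        Literature.AlgebraicGeometry.HodgeTheory.bfSingleAdmissible n X₀ I E)) :=
  ⟨rung_sixfoldMiddleTw_of_residual63, residual63_of_rung_sixfoldMiddleTw⟩

/-- **The registered rung `stub_rung_sixfoldMiddleTw` of crux stmt-HodgeConjecture-19787 (its statement verbatim) ↔ `∀ C, Residual63 C`.**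
[cite: Markman2025SecantWeil, Thm. 1.5.1] [cite: vanGeemen1994HodgeAV, Thm. 4.11] [cite: Bloch1972Semiregularity, Remark (7.5)] -/
theorem forall_residual63_iff_forall_rung :
    (∀ C : ChernCharacterBetti, Residual63 C) ↔
      ∀ C : ChernCharacterBetti, LefAtExceptionalRegimeSixfoldMiddle (Literature.AlgebraicGeometry.HodgeTheory.twistedReflexiveClass C
        (fun n X₀ I E => Summit.Ventures.HSemireg.gluableSigmaAdmissible n X₀ I E ∨
          Literature.AlgebraicGeometry.HodgeTheory.bfSingleAdmissible n X₀ I E)) :=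
  ⟨fun h C ↦ rung_sixfoldMiddleTw_of_residual63 (h C), fun h C ↦ residual63_of_rung_sixfoldMiddleTw (h C)⟩

/-- **THE CRUX `SemiregularSheafRepresentativesTwAtDiag` (item 19787) BY NAME from the `(4, 2)` cell, the `(6, 3)` RESIDUAL and the tail
`m ≥ 4`** — PART AA-d's composition with the anchored carrier DISCHARGED (`anchorCarrier63`): the three remaining inputs are the registered stubs
`stub_firstCell_fourfoldMiddleTw`, (the residual form of) `stub_rung_sixfoldMiddleTw`, `stub_diagonalTailTw` of skeleton v2.
[cite: Bloch1972Semiregularity, Remark (7.5)] [cite: Markman2025SecantWeil, Thm. 1.4.1 and Thm. 1.5.1] [cite: vanGeemen1994HodgeAV, §2.4 and Thm. 4.11] -/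
theorem twAtDiag_of_firstCell_of_residual63_of_tail
    (h₁ : ∀ C : ChernCharacterBetti,
      LefAtExceptionalRegimeAt (Literature.AlgebraicGeometry.HodgeTheory.twistedReflexiveClass C
        (fun n X₀ I E => Summit.Ventures.HSemireg.gluableSigmaAdmissible n X₀ I E ∨
          Literature.AlgebraicGeometry.HodgeTheory.bfSingleAdmissible n X₀ I E)) 4 2)
    (hR : ∀ C : ChernCharacterBetti, Residual63 C)
    (h₃ : ∀ (C : ChernCharacterBetti) (m : ℕ), 4 ≤ m →
      LefAtExceptionalRegimeAt (Literature.AlgebraicGeometry.HodgeTheory.twistedReflexiveClass C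
        (fun n X₀ I E => Summit.Ventures.HSemireg.gluableSigmaAdmissible n X₀ I E ∨
          Literature.AlgebraicGeometry.HodgeTheory.bfSingleAdmissible n X₀ I E)) (2 * m) m) :
    Theses.VHCAbelianSchemesRoad.SemiregularSheafRepresentativesTwAtDiag :=
  twAtDiag_of_firstCell_of_anchoredCarrierAt_of_residual_of_tail (fun C X θ => θ ∈ secantAnchorSixfold C X) secantServedClasses
    h₁ anchorCarrier63 hR h₃

/-- **Transport of the secant-anchor data along isomorphisms, GIVEN that the twisted door respects isomorphisms** (hypothesis inline; the
`htr` input of PART AA-c `not_forall_not_hasServedFibre_63_of_anchor`). [folklore] [cite: HatcherAT2002, Prop. 3.10] -/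
theorem secantAnchor_transport_of_respectsIso
    (hresp : ∀ (n : ℕ) ⦃Y Y' : SchemeOver ℂ⦄ (e : Y' ≅ Y) (I : Finset ℕ) (κ : (q : ℕ) → complexBetti Y (2 * q)),
      Literature.AlgebraicGeometry.HodgeTheory.twistedReflexiveClass C
          (fun n X₀ I E => Summit.Ventures.HSemireg.gluableSigmaAdmissible n X₀ I E ∨
            Literature.AlgebraicGeometry.HodgeTheory.bfSingleAdmissible n X₀ I E) n Y I κ →
        Literature.AlgebraicGeometry.HodgeTheory.twistedReflexiveClass C
          (fun n X₀ I E => Summit.Ventures.HSemireg.gluableSigmaAdmissible n X₀ I E ∨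
            Literature.AlgebraicGeometry.HodgeTheory.bfSingleAdmissible n X₀ I E) n Y' I
          (fun q ↦ complexBetti.map e.hom (2 * q) (κ q))) :
    ∀ ⦃X X' : SchemeOver ℂ⦄ (e : X ≅ X') (θ : complexBetti X 2) (w : complexBetti X (2 * 3)),
      θ ∈ secantAnchorSixfold C X → w ∈ secantServedClasses C X θ →
        complexBetti.map e.inv 2 θ ∈ secantAnchorSixfold C X' ∧
          complexBetti.map e.inv (2 * 3) w ∈ secantServedClasses C X' (complexBetti.map e.inv 2 θ) :=
  fun _ _ e θ w hθ hw ↦ carrierAnchors_transport_of_respectsIso hresp e θ w hθ hw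

end Twisted

end Summit.HodgeConjecture.HodgeConjecture.Ring2.SemiregularRepresentatives

end
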